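import Literature.MathematicalPhysics.QuantumFieldTheory.Balaban1983to89.B13CondTowerAccretiveFloor

/-!
# `Balaban1983to89.B13CondTowerAccretiveFloorMax` — T. Bałaban, *Renormalization group approach to lattice gauge field theories. II.
# Cluster expansions*, Commun. Math. Phys. **116** (1988) 1–22 [Balaban1988RG2Cluster], p. 15 («For the pair (U, 0) the operators are
# symmetric, and the measure is positive»); T. Bałaban, *Propagators for lattice gauge theories in a background field*, Commun. Math. Phys.
# **99** (1985) 389–434 [Balaban1985BackgroundPropagators], Thm 3.11 p. 416, p. 428 («a lower bound γ₀ > 0 independent of k and U»):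
# THE OPTIMAL ACCRETIVE FLOOR OF A CONDITIONED LAYER — the located inequality behind the N10 junctions' ONE positivity `hKacc` made
# DISCHARGEABLE (any known uniform floor enters) and LOSSLESS (equivalent to the real-floor form).

statement-level linear algebra ([folklore]: the set of uniform Rayleigh floors of finitely many real matrices is a closed down-set of `ℝ`,
bounded above as soon as one index type is inhabited, so its supremum is its maximum) over the landed `B13CondTowerAccretiveFloor`
(pub-ymgap dag-n10-w4 g2, p594910 ∕ p597947: `accretiveFloor`, `rayleighFloor_accretiveFloor`, `hKacc_condTower_of_rayleighFloor`) and the tower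
modules `Node00/CarriersB13CondTower` ∕ `…DecoratedTower` (dag-n10-w3, S5 ∕ S6); kernel-checked; theorems + two `def`s (`rayleighFloorSet`,
`accretiveFloorMax`; no `structure`, no instance, no notation); nothing of the imported modules is modified (successor-module discipline — the v1.2
content of `B13CondTowerAccretiveFloor` filed as its own module to keep both files under the 400-line guide); nothing here is a claim about the
Yang–Mills mass gap; nothing of Bałaban's operators is constructed or asserted; no node is discharged; count-neutral.

WHY THIS FILE (cell `pub-ymgap`, Track A node N10 = [B13]; width seat `pub-ymgap-dag-n10-w4` g3, INTENT-2 — own-stem successor of the seat's g2 files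
under the all-located junction edition «67RDL», INTENT-1 `Thm/BalabanUVNodesN10B13KernelTowerWalksEntrywiseNumeralsDecoratedDialsLocated`).  The g2 file
names the numeral `accretiveFloor lamC := Classical.choose (…)` — SOME positive uniform real Rayleigh floor of the reference values `K₀ Z t` — and
proves that `m₀ ≤ accretiveFloor lamC` IMPLIES the junctions' binder `hKacc` at margin `m₀`.  But a `Classical.choose`-numeral admits no lower bound
beyond its specification: a consumer who KNOWS a uniform floor `γ` of the `K₀ Z t` (a coercivity constant proved for the record's reference values —
ultimately N06's Thm 3.11 ∕ [13] p. 428 content at Bałaban's objects) cannot conclude `γ ≤ accretiveFloor lamC`, so the located inequality of g2 is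
dischargeable only by DEFINING the rung's margin from the numeral.  THIS FILE names the RIGHT numeral: the OPTIMAL floor `accretiveFloorMax lamC`
(the maximum of the closed set of uniform floors), for which `γ ≤ accretiveFloorMax lamC` holds for EVERY uniform floor `γ` and the located
inequality `m₀ ≤ accretiveFloorMax lamC` is EQUIVALENT to the real-floor form of `hKacc` at margin `m₀` (for a layer with at least one bond; the
bond-free layer's `hKacc` is vacuous and the numeral is then the positive guard `accretiveFloor lamC`).  The all-located junction 67RDL displays
`hm₀ : rf.m₀ ≤ accretiveFloorMax lamD.toC` over this file.

WHAT THIS FILE PROVES (all `theorem`s but the two `def`s).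
* §1 private plumbing [folklore]: `rayleighFloor_mono'` (the floor property is antitone in the margin; the g2 file's private twin restated).
* §2 `rayleighFloorSet lamC` (`mem_rayleighFloorSet_iff`, `accretiveFloor_mem_rayleighFloorSet`, `mem_rayleighFloorSet_of_le` (down-set),
  `isClosed_rayleighFloorSet`, `bddAbove_rayleighFloorSet` (one inhabited bond index type suffices)); ★ `accretiveFloorMax lamC := max (sSup …) (accretiveFloor lamC)`
  (`accretiveFloor_le_accretiveFloorMax`, `accretiveFloorMax_pos`, `accretiveFloorMax_mem_rayleighFloorSet` (`IsClosed.csSup_mem`), `rayleighFloor_accretiveFloorMax`);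
  ★ `le_accretiveFloorMax_of_rayleighFloor` ∕ `le_accretiveFloorMax_of_coercive` (MAXIMALITY — the consumer's introduction rule); ★ `le_accretiveFloorMax_iff`
  (LOSSLESS); `coercive_K₀_accretiveFloorMax`, `refAcc_of_le_accretiveFloorMax`; the supply lemmas `hKacc_condTower_of_le_accretiveFloorMax` (62 ∕ 64's binder
  text at `lamC.toK`) and ★ `hKacc_decTower_of_le_accretiveFloorMax` (67's binder text at `lamD.toC`); `le_accretiveFloorMax_decTower_of_rayleighFloor` (67's
  real-floor hypothesis ⟹ the located inequality).
HONEST FRAMING: located bookkeeping + two order-topology facts of `ℝ`; `accretiveFloorMax` is a finite-lattice number read off the record's DATA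
`K₀ Z t` over the WHOLE index type `B13TermIdx` (⊇ print's terms `terms … Z`, as the carrier's law `hpd` is stated) — print's k- and U-UNIFORM γ₀ of
[13] p. 428 is NEITHER proved NOR claimed, and which `K₀` the record of a member HAS is def-T's term tower; the other NODE-A binders are untouched;
N10 NOT discharged; K1⁷ NOT closed; counts unmoved (typed 28∕28 · discharged 5∕27); no `sorry`, no new named fact; standard axioms; one finite 𝕋⁴
programme at fixed ε, Bałaban AS PRINTED; the YM mass gap (Clay) is NOT proved by any of this — R4 closes the conditional finite-𝕋⁴ rung
`BalabanLadder.UV` only; nothing continuum ∕ ℝ⁴ ∕ OS.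
A2 ∕ A6: `rayleighFloorSet lamC` is inhabited (`accretiveFloor_mem_rayleighFloorSet`) for EVERY `lamC` (the type `ResidB13C θ` is inhabited,
`Node00.nonempty_residB13C`); the located inequality `m₀ ≤ accretiveFloorMax lamC` is inhabited by every `m₀ ≤ accretiveFloor lamC`, in particular by a
POSITIVE margin (`accretiveFloorMax_pos`).

References: T. Bałaban, CMP 116 (1988) 1–22 [Balaban1988RG2Cluster] (2.5)–(2.8) pp.12–14, (2.14) p.15, p.15; CMP 99 (1985) 389–434
[Balaban1985BackgroundPropagators] Thm 3.11 p.416, p.428.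
-/

noncomputable section

namespace Literature.MathematicalPhysics.QuantumFieldTheory.Balaban1983to89.B13CondTowerAccretiveFloorMax

open Finset Metric
open scoped Matrix
open Literature.MathematicalPhysics.QuantumFieldTheory.Balaban1983to89
open Literature.MathematicalPhysics.QuantumFieldTheory.Balaban1983to89.Node00 (Stage3Params ResidB13C ResidB13D B13TermIdx)
open Literature.MathematicalPhysics.QuantumFieldTheory.Balaban1983to89.TreeLengthTorus (TDom TPt)
open Literature.MathematicalPhysics.QuantumFieldTheory.Balaban1983to89.B13Lemma3TorusTerms (terms)
open Literature.MathematicalPhysics.QuantumFieldTheory.Balaban1983to89.B13CondTowerAccretiveFloor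
  (accretiveFloor accretiveFloor_pos rayleighFloor_accretiveFloor hKacc_condTower_of_rayleighFloor coercive_iff_rayleighFloor)

/-! ## §1. Plumbing: the floor property is antitone in the margin -/

section Plumbing

variable {n : Type*} [Fintype n]

/-- The Rayleigh floor is ANTITONE in the margin: a bound at `m` is a bound at every `m′ ≤ m` (the imported module's private twin, restated; plumbing). [folklore] -/
private theorem rayleighFloor_mono' {K₀ : Matrix n n ℝ} {m m' : ℝ} (hm : ∀ x : n → ℝ, m * ∑ i, x i ^ 2 ≤ ∑ i, x i * (K₀ *ᵥ x) i)
    (h : m' ≤ m) : ∀ x : n → ℝ, m' * ∑ i, x i ^ 2 ≤ ∑ i, x i * (K₀ *ᵥ x) i := fun x =>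
  (mul_le_mul_of_nonneg_right h (Finset.sum_nonneg fun i _ => sq_nonneg (x i))).trans (hm x)

end Plumbing

/-! ## §2. The OPTIMAL floor `accretiveFloorMax lamC`: the located inequality made DISCHARGEABLE and LOSSLESS -/

section FloorMax

variable {θ : Stage3Params}

/-- **THE SET OF UNIFORM REAL RAYLEIGH FLOORS OF A CONDITIONED LAYER**: the real numbers `m` with `m·Σᵢ xᵢ² ≤ Σᵢ xᵢ (K₀ Z t x)ᵢ` for EVERY
reference value `K₀ Z t` of the layer and every real `x` — the content of the junctions' `hKacc` at margin `m` read on the record's laws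
(`refAcc_toK`).  A down-set containing `accretiveFloor lamC > 0`. [cite: Balaban1988RG2Cluster, p.15; Balaban1985BackgroundPropagators, Thm 3.11 p.416] -/
def rayleighFloorSet (lamC : ResidB13C θ) : Set ℝ :=
  {m : ℝ | ∀ (Z : TDom 4 (lamC.n + 1)) (t : B13TermIdx θ lamC.n lamC.m₃) (x : lamC.Λ Z t ⊕ lamC.C₀ Z t → ℝ),
    m * ∑ i, x i ^ 2 ≤ ∑ i, x i * (lamC.K₀ Z t *ᵥ x) i}

/-- Membership is the uniform Rayleigh-floor property (`Iff.rfl`). [cite: Balaban1988RG2Cluster, p.15] -/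
theorem mem_rayleighFloorSet_iff (lamC : ResidB13C θ) (m : ℝ) :
    m ∈ rayleighFloorSet lamC ↔ ∀ (Z : TDom 4 (lamC.n + 1)) (t : B13TermIdx θ lamC.n lamC.m₃) (x : lamC.Λ Z t ⊕ lamC.C₀ Z t → ℝ),
      m * ∑ i, x i ^ 2 ≤ ∑ i, x i * (lamC.K₀ Z t *ᵥ x) i :=
  Iff.rfl

/-- The module-1 floor `accretiveFloor` is a uniform Rayleigh floor (so the set is non-empty). [cite: Balaban1988RG2Cluster, p.15] -/
theorem accretiveFloor_mem_rayleighFloorSet (lamC : ResidB13C θ) : accretiveFloor lamC ∈ rayleighFloorSet lamC :=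
  fun Z t x => rayleighFloor_accretiveFloor lamC Z t x

/-- The floor set is a DOWN-SET (the property is antitone in the margin). [folklore] [cite: Balaban1988RG2Cluster, p.15] -/
theorem mem_rayleighFloorSet_of_le (lamC : ResidB13C θ) {m m' : ℝ} (hm : m ∈ rayleighFloorSet lamC) (h : m' ≤ m) :
    m' ∈ rayleighFloorSet lamC :=
  fun Z t => rayleighFloor_mono' (hm Z t) h

/-- The floor set is CLOSED (an intersection of closed half-lines `{m | m·c ≤ d}`). [folklore] [cite: Balaban1988RG2Cluster, p.15] -/
theorem isClosed_rayleighFloorSet (lamC : ResidB13C θ) : IsClosed (rayleighFloorSet lamC) := by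
  have h : rayleighFloorSet lamC = ⋂ (Z : TDom 4 (lamC.n + 1)), ⋂ (t : B13TermIdx θ lamC.n lamC.m₃), ⋂ (x : lamC.Λ Z t ⊕ lamC.C₀ Z t → ℝ),
      {m : ℝ | m * ∑ i, x i ^ 2 ≤ ∑ i, x i * (lamC.K₀ Z t *ᵥ x) i} := by
    ext m
    simp only [rayleighFloorSet, Set.mem_setOf_eq, Set.mem_iInter]
  rw [h]
  exact isClosed_iInter fun Z => isClosed_iInter fun t => isClosed_iInter fun x =>
    isClosed_le (continuous_id.mul continuous_const) continuous_const

/-- If SOME term has a bond (its index type `Λ Z t ⊕ C₀ Z t` is inhabited) the floor set is BOUNDED ABOVE (test the floor inequality on the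
indicator of that bond: `m ≤ (K₀ Z t)ᵢᵢ`). [folklore] [cite: Balaban1985BackgroundPropagators, Thm 3.11 p.416] -/
theorem bddAbove_rayleighFloorSet (lamC : ResidB13C θ)
    (hne : ∃ (Z : TDom 4 (lamC.n + 1)) (t : B13TermIdx θ lamC.n lamC.m₃), Nonempty (lamC.Λ Z t ⊕ lamC.C₀ Z t)) :
    BddAbove (rayleighFloorSet lamC) := by
  classical
  obtain ⟨Z, t, ⟨i₀⟩⟩ := hne
  refine ⟨∑ i, (Pi.single i₀ (1 : ℝ) : lamC.Λ Z t ⊕ lamC.C₀ Z t → ℝ) i * (lamC.K₀ Z t *ᵥ Pi.single i₀ 1) i, fun m hm => ?_⟩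
  have h := hm Z t (Pi.single i₀ 1)
  have hsq : ∑ i, (Pi.single i₀ (1 : ℝ) : lamC.Λ Z t ⊕ lamC.C₀ Z t → ℝ) i ^ 2 = 1 := by
    rw [Finset.sum_eq_single i₀ (fun j _ hj => by simp [hj]) (fun h => absurd (Finset.mem_univ _) h)]
    simp
  simpa [hsq] using h

/-- ★ **THE OPTIMAL ACCRETIVE FLOOR `accretiveFloorMax lamC`**: the LARGEST uniform real Rayleigh floor of the layer's reference values
`K₀ Z t` (the supremum of the floor set — a maximum, the set being closed —, guarded by `max … (accretiveFloor lamC)` so that the degenerate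
bond-free layer, whose floor set is all of `ℝ`, still gets a positive numeral).  THE POINT: against THIS numeral the located inequality
`m₀ ≤ accretiveFloorMax lamC` is not only SUFFICIENT for the junctions' `hKacc` at margin `m₀` but EQUIVALENT to its real Rayleigh form
(`le_accretiveFloorMax_iff`) — a consumer holding ANY uniform floor `γ` (e.g. a coercivity constant of the reference values proved elsewhere)
discharges the inequality by `le_accretiveFloorMax_of_rayleighFloor`, which the `Classical.choose`-numeral `accretiveFloor` of `B13CondTowerAccretiveFloor` §4 does not allow.
A finite-lattice number of the record's DATA; NOT print's k-∕U-uniform γ₀. [cite: Balaban1988RG2Cluster, p.15; Balaban1985BackgroundPropagators, Thm 3.11 p.416, p.428] -/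
def accretiveFloorMax (lamC : ResidB13C θ) : ℝ :=
  max (sSup (rayleighFloorSet lamC)) (accretiveFloor lamC)

/-- The optimal floor dominates `accretiveFloor`. [cite: Balaban1988RG2Cluster, p.15] -/
theorem accretiveFloor_le_accretiveFloorMax (lamC : ResidB13C θ) : accretiveFloor lamC ≤ accretiveFloorMax lamC :=
  le_max_right _ _

/-- The optimal floor is POSITIVE. [cite: Balaban1988RG2Cluster, p.15] -/
theorem accretiveFloorMax_pos (lamC : ResidB13C θ) : 0 < accretiveFloorMax lamC :=
  (accretiveFloor_pos lamC).trans_le (accretiveFloor_le_accretiveFloorMax lamC)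

/-- The optimal floor IS a uniform Rayleigh floor (the supremum of a non-empty closed bounded set belongs to it; in the unbounded case the
guard takes over). [folklore] [cite: Balaban1988RG2Cluster, p.15] -/
theorem accretiveFloorMax_mem_rayleighFloorSet (lamC : ResidB13C θ) : accretiveFloorMax lamC ∈ rayleighFloorSet lamC := by
  unfold accretiveFloorMax
  rcases le_total (sSup (rayleighFloorSet lamC)) (accretiveFloor lamC) with h | h
  · rw [max_eq_right h]; exact accretiveFloor_mem_rayleighFloorSet lamC
  · rw [max_eq_left h]
    by_cases hb : BddAbove (rayleighFloorSet lamC)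
    · exact (isClosed_rayleighFloorSet lamC).csSup_mem ⟨_, accretiveFloor_mem_rayleighFloorSet lamC⟩ hb
    · have h0 : sSup (rayleighFloorSet lamC) = 0 := Real.sSup_of_not_bddAbove hb
      exact mem_rayleighFloorSet_of_le lamC (accretiveFloor_mem_rayleighFloorSet lamC) (h0 ▸ (accretiveFloor_pos lamC).le)

/-- The optimal floor is a real Rayleigh floor of EVERY reference value `K₀ Z t`. [cite: Balaban1988RG2Cluster, p.15] -/
theorem rayleighFloor_accretiveFloorMax (lamC : ResidB13C θ) (Z : TDom 4 (lamC.n + 1)) (t : B13TermIdx θ lamC.n lamC.m₃)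
    (x : lamC.Λ Z t ⊕ lamC.C₀ Z t → ℝ) :
    accretiveFloorMax lamC * ∑ i, x i ^ 2 ≤ ∑ i, x i * (lamC.K₀ Z t *ᵥ x) i :=
  accretiveFloorMax_mem_rayleighFloorSet lamC Z t x

/-- ★ **MAXIMALITY — THE CONSUMER's INTRODUCTION RULE**: every uniform real Rayleigh floor `γ` of the layer's reference values is BELOW the
optimal floor, provided some term has a bond (else the statement `hKacc` is vacuous anyway).  So `γ ≤ accretiveFloorMax lamC` is how a
coercivity constant proved for the `K₀ Z t` enters the junctions' located inequality. [folklore] [cite: Balaban1985BackgroundPropagators, Thm 3.11 p.416, p.428] -/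
theorem le_accretiveFloorMax_of_rayleighFloor (lamC : ResidB13C θ) {γ : ℝ}
    (hγ : ∀ (Z : TDom 4 (lamC.n + 1)) (t : B13TermIdx θ lamC.n lamC.m₃) (x : lamC.Λ Z t ⊕ lamC.C₀ Z t → ℝ),
      γ * ∑ i, x i ^ 2 ≤ ∑ i, x i * (lamC.K₀ Z t *ᵥ x) i)
    (hne : ∃ (Z : TDom 4 (lamC.n + 1)) (t : B13TermIdx θ lamC.n lamC.m₃), Nonempty (lamC.Λ Z t ⊕ lamC.C₀ Z t)) :
    γ ≤ accretiveFloorMax lamC :=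
  (le_csSup (bddAbove_rayleighFloorSet lamC hne) hγ).trans (le_max_left _ _)

/-- ★ **THE LOCATED INEQUALITY IS LOSSLESS**: for a layer with at least one bond, `m₀ ≤ accretiveFloorMax lamC` holds IF AND ONLY IF `m₀` is a
uniform real Rayleigh floor of the reference values — the real form of the junctions' `hKacc` at margin `m₀`. [cite: Balaban1988RG2Cluster, p.15] -/
theorem le_accretiveFloorMax_iff (lamC : ResidB13C θ)
    (hne : ∃ (Z : TDom 4 (lamC.n + 1)) (t : B13TermIdx θ lamC.n lamC.m₃), Nonempty (lamC.Λ Z t ⊕ lamC.C₀ Z t)) (m₀ : ℝ) :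
    m₀ ≤ accretiveFloorMax lamC ↔
      ∀ (Z : TDom 4 (lamC.n + 1)) (t : B13TermIdx θ lamC.n lamC.m₃) (x : lamC.Λ Z t ⊕ lamC.C₀ Z t → ℝ),
        m₀ * ∑ i, x i ^ 2 ≤ ∑ i, x i * (lamC.K₀ Z t *ᵥ x) i :=
  ⟨fun h Z t => rayleighFloor_mono' (rayleighFloor_accretiveFloorMax lamC Z t) h,
    fun h => le_accretiveFloorMax_of_rayleighFloor lamC h hne⟩

/-- The tree's real coercivity currency enters the same way: `QGQInverse.Coercive (K₀ Z t) γ` for all terms ⟹ `γ ≤ accretiveFloorMax lamC`.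
[cite: Balaban1985BackgroundPropagators, Thm 3.11 p.416] -/
theorem le_accretiveFloorMax_of_coercive (lamC : ResidB13C θ) {γ : ℝ}
    (hγ : ∀ (Z : TDom 4 (lamC.n + 1)) (t : B13TermIdx θ lamC.n lamC.m₃), QGQInverse.Coercive (lamC.K₀ Z t) γ)
    (hne : ∃ (Z : TDom 4 (lamC.n + 1)) (t : B13TermIdx θ lamC.n lamC.m₃), Nonempty (lamC.Λ Z t ⊕ lamC.C₀ Z t)) :
    γ ≤ accretiveFloorMax lamC := by
  classical
  exact le_accretiveFloorMax_of_rayleighFloor lamC (fun Z t => (coercive_iff_rayleighFloor (lamC.K₀ Z t) γ).1 (hγ Z t)) hne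

/-- Every `K₀ Z t` is coercive at the optimal floor. [cite: Balaban1985BackgroundPropagators, Thm 3.11 p.416] -/
theorem coercive_K₀_accretiveFloorMax (lamC : ResidB13C θ) (Z : TDom 4 (lamC.n + 1)) (t : B13TermIdx θ lamC.n lamC.m₃) :
    QGQInverse.Coercive (lamC.K₀ Z t) (accretiveFloorMax lamC) := by
  classical
  exact (coercive_iff_rayleighFloor (lamC.K₀ Z t) (accretiveFloorMax lamC)).2 (rayleighFloor_accretiveFloorMax lamC Z t)

/-- The per-term complex positivity at EVERY margin below the optimal floor. [cite: Balaban1988RG2Cluster, p.15] -/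
theorem refAcc_of_le_accretiveFloorMax (lamC : ResidB13C θ) {m₀ : ℝ} (hm₀ : m₀ ≤ accretiveFloorMax lamC)
    (Z : TDom 4 (lamC.n + 1)) (t : B13TermIdx θ lamC.n lamC.m₃) (v : lamC.Λ Z t ⊕ lamC.C₀ Z t → ℂ) :
    m₀ * ∑ i, ‖v i‖ ^ 2 ≤ (∑ i, star (v i) * (lamC.KK Z t 0 0 *ᵥ v) i).re :=
  Node00.refAcc_toK lamC Z t (rayleighFloor_mono' (rayleighFloor_accretiveFloorMax lamC Z t) hm₀) v

/-- ★ **THE JUNCTIONS' `hKacc` (62 ∕ 64, at `lamC.toK`) FROM THE LOCATED INEQUALITY `m₀ ≤ accretiveFloorMax lamC`.**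
[cite: Balaban1988RG2Cluster, (2.5)–(2.7) pp.12–13, (2.14) p.15, p.15] -/
theorem hKacc_condTower_of_le_accretiveFloorMax (lamC : ResidB13C θ) {m₀ : ℝ} (hm₀ : m₀ ≤ accretiveFloorMax lamC) :
    ∀ Z, ∀ t ∈ terms (θ.ℓ₆ + 1) (lamC.toK.layer.m₃ + 1) Z, ∀ v : (lamC.toK.𝒦 Z t).Λ ⊕ (lamC.toK.𝒦 Z t).C₀ → ℂ,
      m₀ * ∑ i, ‖v i‖ ^ 2 ≤ (∑ i, star (v i) * (lamC.KK Z t 0 0 *ᵥ v) i).re :=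
  hKacc_condTower_of_rayleighFloor lamC fun Z t => rayleighFloor_mono' (rayleighFloor_accretiveFloorMax lamC Z t) hm₀

/-- ★ **MODULE 67's `hKacc` (at `lamD.toC`) FROM THE LOCATED INEQUALITY `rf.m₀ ≤ accretiveFloorMax lamD.toC`** — the form the ALL-LOCATED
junction edition (67RDL) displays. [cite: Balaban1988RG2Cluster, (2.5)–(2.8) pp.12–14, (2.14) p.15, p.15] -/
theorem hKacc_decTower_of_le_accretiveFloorMax (lamD : ResidB13D θ) {m₀ : ℝ} (hm₀ : m₀ ≤ accretiveFloorMax lamD.toC) :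
    ∀ Z, ∀ t ∈ terms (θ.ℓ₆ + 1) (lamD.toC.toK.layer.m₃ + 1) Z, ∀ v : (lamD.toC.toK.𝒦 Z t).Λ ⊕ (lamD.toC.toK.𝒦 Z t).C₀ → ℂ,
      m₀ * ∑ i, ‖v i‖ ^ 2 ≤ (∑ i, star (v i) * (lamD.toC.KK Z t 0 0 *ᵥ v) i).re :=
  hKacc_condTower_of_le_accretiveFloorMax lamD.toC hm₀

/-- ★ **CONVERSELY, MODULE 67's REAL-FORM POSITIVITY GIVES THE LOCATED INEQUALITY**: a common real Rayleigh floor `m₀` of the decorated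
layer's reference values `lamD.K₀ Z t` (the hypothesis `hm` of `B13CondTowerAccretiveFloor.hKacc_decTower_of_rayleighFloor`) is below the optimal floor — the
located edition loses nothing against the real-floor edition. [cite: Balaban1988RG2Cluster, p.15] -/
theorem le_accretiveFloorMax_decTower_of_rayleighFloor (lamD : ResidB13D θ) {m₀ : ℝ}
    (hm : ∀ (Z : TDom 4 (lamD.n + 1)) (t : B13TermIdx θ lamD.n lamD.m₃) (x : lamD.Λ Z t ⊕ lamD.C₀ Z t → ℝ),
      m₀ * ∑ i, x i ^ 2 ≤ ∑ i, x i * (lamD.K₀ Z t *ᵥ x) i)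
    (hne : ∃ (Z : TDom 4 (lamD.n + 1)) (t : B13TermIdx θ lamD.n lamD.m₃), Nonempty (lamD.Λ Z t ⊕ lamD.C₀ Z t)) :
    m₀ ≤ accretiveFloorMax lamD.toC :=
  le_accretiveFloorMax_of_rayleighFloor lamD.toC hm hne

end FloorMax

end Literature.MathematicalPhysics.QuantumFieldTheory.Balaban1983to89.B13CondTowerAccretiveFloorMax

end
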